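import Summits.CriticalPhenomena.PercolationContinuityZ3.Theorems.Transplant.FKConnectivityAllQAntipodalOrAttSides
import HarnessLib

/-!
# Connectivity correlation inequalities for `φ_{w,q}`, every `q > 0` — file 47e₀: INPUTS of the OR-attached drift induction — the rootless
# `O`, and the master-theorem oracles in the shape produced by the junction identities

Support file (`--supports stmt-CriticalPhenomena-4575`), FK sub-lane `prim-bschramm-fk-2` (gen 22); builds on p205010 (kernel theorem,
internal audit signed; external expert review pending).  No definitions, no named facts, no sorries; standard axioms.

`O(N; y, z; C) = D(yzC | C) + D(zC | yC) + D(yC | zC)` (module docstring of `…OrAttSides`).  This file packages, for a sub-network `F` of the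
host and the cell `(N ∩ F, C ∩ F)`, the inequalities that the junction lemmas of `…OrAttSeries`, `…OrAttSeriesSame`, `…OrAttParallel` consume:
`FK.orAttW_rootless_nonpos` (the rootless `O` is a rootless AND-contracted drift plus a cancelling pair), and the instances of the master weighted
AND theorem (`…AndGenWeightPath` via `…OrAttSides`): the U-drift of `(N ∩ F) ∪ {e}` (`FK.orAtt_inU`), the AND-contracted drift with and
without root (`FK.orAtt_inA`, `FK.orAtt_inR`, `FK.orAtt_inRR`), the plain U-drift (`FK.orAtt_inP`), and the `st`-contracted drifts of a
parallel strand (`FK.orAtt_inK`, `FK.orAtt_inKK`).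
[cite: Grimmett2006, §1.4 eq. (1.20) (p. 15); §3.8 Thm. (3.90) (pp. 61–62); §3.9 (pp. 63–64)] [cite: Wagner2006, Thm. 5.8(d), §5.3]
-/

noncomputable section

namespace Summit.CriticalPhenomena.PercolationContinuityZ3.Theorems

namespace FK

open SimpleGraph Literature.Probability.LatticeModels Literature.Probability.Percolation
open scoped Classical

variable {V : Type*} [Fintype V]

section OrAttInputs

/-- **The ROOTLESS OR-attached drift is signed** (no induction): `F` TTSP between `u, v`, `N ⊆ F` free, `C ⊆ F ∪ {uv}`, `y, z ∈ F ∪ {uv}` outside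
`N ∪ C`, `N ∩ C = ∅`, `w` antitone, `h` monotone ⟹ the rootless drifts `(yzC|C) + (zC|yC) + (yC|zC)` add up to `≤ 0` — the first is a rootless
AND-contracted drift (`FK.andGenW_rootless_nonpos_of_isTTSP`), the other two cancel (`FK.twoSidedW_swap`).
[cite: Grimmett2006, §3.8 Thm. (3.90) (pp. 61–62)] [cite: Wagner2006, Thm. 5.8(d), §5.3] -/
theorem orAttW_rootless_nonpos {F : Finset (Sym2 V)} {u v : V} {N C : Finset (Sym2 V)} {y z : Sym2 V} (hFT : IsTTSP F u v)
    (hN : N ⊆ F) (hC : C ⊆ insert s(u, v) F) (hy : y ∈ insert s(u, v) F) (hz : z ∈ insert s(u, v) F)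
    (hyN : y ∉ N) (hzN : z ∉ N) (hNC : Disjoint N C)
    {w : ℕ → ℝ} (hw : ∀ k : ℕ, w (k + 1) ≤ w k)
    {h : Finset (Sym2 V) → ℝ} (hm : ∀ ⦃X Y : Finset (Sym2 V)⦄, X ⊆ Y → Y ⊆ N → h X ≤ h Y) :
    ∑ γ ∈ N.powerset,
        (w (clusterCount (↑(γ ∪ insert y (insert z C)) : BondConfig V) ∅ + clusterCount (↑(N \ γ ∪ C) : BondConfig V) ∅) -
          w (clusterCount (↑(N \ γ ∪ insert y (insert z C)) : BondConfig V) ∅ + clusterCount (↑(γ ∪ C) : BondConfig V) ∅)) * h γ +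
      ∑ γ ∈ N.powerset,
        (w (clusterCount (↑(γ ∪ insert z C) : BondConfig V) ∅ + clusterCount (↑(N \ γ ∪ insert y C) : BondConfig V) ∅) -
          w (clusterCount (↑(N \ γ ∪ insert z C) : BondConfig V) ∅ + clusterCount (↑(γ ∪ insert y C) : BondConfig V) ∅)) * h γ +
      ∑ γ ∈ N.powerset,
        (w (clusterCount (↑(γ ∪ insert y C) : BondConfig V) ∅ + clusterCount (↑(N \ γ ∪ insert z C) : BondConfig V) ∅) -
          w (clusterCount (↑(N \ γ ∪ insert y C) : BondConfig V) ∅ + clusterCount (↑(γ ∪ insert z C) : BondConfig V) ∅)) * h γ ≤ 0 := by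
  have h0 := twoSidedW_swap w N (insert z C) (insert y C) h
  have h1 := andGenW_rootless_nonpos_of_isTTSP hFT hN (A := insert y (insert z C)) (C := C)
    (Finset.insert_subset hy (Finset.insert_subset hz hC)) ((Finset.subset_insert _ _).trans (Finset.subset_insert _ _))
    (Finset.disjoint_insert_right.2 ⟨hyN, Finset.disjoint_insert_right.2 ⟨hzN, hNC⟩⟩) hw hm
  linarith

/-- Oracle: the U-drift of the free set `(N ∩ F) ∪ {e}` with contracted `C ∩ F`, root `ab` (possibly an edge of `F`).
[cite: Grimmett2006, §3.8 Thm. (3.90) (pp. 61–62)] -/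
theorem orAtt_inU {N C F : Finset (Sym2 V)} {a b : V} {e : Sym2 V} (hF : IsTTSP F a b) (he : e ∈ F) (heC : e ∉ C) (hNC : Disjoint N C) :
    ∀ w' : ℕ → ℝ, (∀ k : ℕ, w' (k + 1) ≤ w' k) → ∀ h' : Finset (Sym2 V) → ℝ,
      (∀ ⦃A B : Finset (Sym2 V)⦄, A ⊆ B → B ⊆ insert e (N ∩ F) → h' A ≤ h' B) →
      ∑ γ ∈ (insert e (N ∩ F)).powerset, (w' (clusterCount (↑(insert s(a, b) (γ ∪ C ∩ F)) : BondConfig V) ∅ +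
          clusterCount (↑(insert e (N ∩ F) \ γ ∪ C ∩ F) : BondConfig V) ∅) -
        w' (clusterCount (↑(insert s(a, b) (insert e (N ∩ F) \ γ ∪ C ∩ F)) : BondConfig V) ∅ +
          clusterCount (↑(γ ∪ C ∩ F) : BondConfig V) ∅)) * h' γ ≤ 0 :=
  fun _ hw' _ hm' => andGenW_virt_nonpos_of_isTTSP hF (Finset.insert_subset he Finset.inter_subset_right) Finset.inter_subset_right
    subset_rfl (Finset.disjoint_insert_left.2 ⟨fun hh => heC (Finset.mem_of_mem_inter_left hh),
      Finset.disjoint_of_subset_left Finset.inter_subset_left (Finset.disjoint_of_subset_right Finset.inter_subset_left hNC)⟩) hw' hm'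

/-- Oracle: the AND-contracted drift `(e, C ∩ F | C ∩ F)` of the free set `N ∩ F`, root `ab` (possibly an edge of `F`).
[cite: Grimmett2006, §3.8 Thm. (3.90) (pp. 61–62)] -/
theorem orAtt_inA {N C F : Finset (Sym2 V)} {a b : V} {e : Sym2 V} (hF : IsTTSP F a b) (he : e ∈ F) (heN : e ∉ N) (hNC : Disjoint N C) :
    ∀ w' : ℕ → ℝ, (∀ k : ℕ, w' (k + 1) ≤ w' k) → ∀ h' : Finset (Sym2 V) → ℝ,
      (∀ ⦃A B : Finset (Sym2 V)⦄, A ⊆ B → B ⊆ N ∩ F → h' A ≤ h' B) →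
      ∑ γ ∈ (N ∩ F).powerset, (w' (clusterCount (↑(insert s(a, b) (γ ∪ insert e (C ∩ F))) : BondConfig V) ∅ +
          clusterCount (↑((N ∩ F) \ γ ∪ C ∩ F) : BondConfig V) ∅) -
        w' (clusterCount (↑(insert s(a, b) ((N ∩ F) \ γ ∪ insert e (C ∩ F))) : BondConfig V) ∅ +
          clusterCount (↑(γ ∪ C ∩ F) : BondConfig V) ∅)) * h' γ ≤ 0 :=
  fun _ hw' _ hm' => andGenW_virt_nonpos_of_isTTSP hF Finset.inter_subset_right (Finset.insert_subset he Finset.inter_subset_right)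
    (Finset.subset_insert _ _) (Finset.disjoint_insert_right.2 ⟨fun hh => heN (Finset.mem_of_mem_inter_left hh),
      Finset.disjoint_of_subset_left Finset.inter_subset_left (Finset.disjoint_of_subset_right Finset.inter_subset_left hNC)⟩) hw' hm'

/-- Oracle: the rootless AND-contracted drift `(e, C ∩ F | C ∩ F)` of the free set `N ∩ F`. [cite: Grimmett2006, §3.8 Thm. (3.90) (pp. 61–62)] -/
theorem orAtt_inR {N C F : Finset (Sym2 V)} {a b : V} {e : Sym2 V} (hF : IsTTSP F a b) (he : e ∈ F) (heN : e ∉ N) (hNC : Disjoint N C) :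
    ∀ w' : ℕ → ℝ, (∀ k : ℕ, w' (k + 1) ≤ w' k) → ∀ h' : Finset (Sym2 V) → ℝ,
      (∀ ⦃A B : Finset (Sym2 V)⦄, A ⊆ B → B ⊆ N ∩ F → h' A ≤ h' B) →
      ∑ γ ∈ (N ∩ F).powerset, (w' (clusterCount (↑(γ ∪ insert e (C ∩ F)) : BondConfig V) ∅ +
          clusterCount (↑((N ∩ F) \ γ ∪ C ∩ F) : BondConfig V) ∅) -
        w' (clusterCount (↑((N ∩ F) \ γ ∪ insert e (C ∩ F)) : BondConfig V) ∅ + clusterCount (↑(γ ∪ C ∩ F) : BondConfig V) ∅)) *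
          h' γ ≤ 0 :=
  fun _ hw' _ hm' => andGenW_rootless_nonpos_of_isTTSP hF Finset.inter_subset_right
    ((Finset.insert_subset he Finset.inter_subset_right).trans (Finset.subset_insert _ _)) (Finset.subset_insert _ _)
    (Finset.disjoint_insert_right.2 ⟨fun hh => heN (Finset.mem_of_mem_inter_left hh),
      Finset.disjoint_of_subset_left Finset.inter_subset_left (Finset.disjoint_of_subset_right Finset.inter_subset_left hNC)⟩) hw' hm'

/-- Oracle: the rootless AND-contracted drift `(y, z, C ∩ F | C ∩ F)` of the free set `N ∩ F` (the rootless `O` after cancellation).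
[cite: Grimmett2006, §3.8 Thm. (3.90) (pp. 61–62)] -/
theorem orAtt_inRR {N C F : Finset (Sym2 V)} {a b : V} {y z : Sym2 V} (hF : IsTTSP F a b) (hyF : y ∈ F) (hzF : z ∈ F) (hyN : y ∉ N)
    (hzN : z ∉ N) (hNC : Disjoint N C) :
    ∀ w' : ℕ → ℝ, (∀ k : ℕ, w' (k + 1) ≤ w' k) → ∀ h' : Finset (Sym2 V) → ℝ,
      (∀ ⦃A B : Finset (Sym2 V)⦄, A ⊆ B → B ⊆ N ∩ F → h' A ≤ h' B) →
      ∑ γ ∈ (N ∩ F).powerset, (w' (clusterCount (↑(γ ∪ insert y (insert z (C ∩ F))) : BondConfig V) ∅ +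
          clusterCount (↑((N ∩ F) \ γ ∪ C ∩ F) : BondConfig V) ∅) -
        w' (clusterCount (↑((N ∩ F) \ γ ∪ insert y (insert z (C ∩ F))) : BondConfig V) ∅ +
          clusterCount (↑(γ ∪ C ∩ F) : BondConfig V) ∅)) * h' γ ≤ 0 :=
  fun _ hw' _ hm' => andGenW_rootless_nonpos_of_isTTSP hF Finset.inter_subset_right
    (Finset.insert_subset (Finset.mem_insert_of_mem hyF) (Finset.insert_subset (Finset.mem_insert_of_mem hzF)
      (Finset.inter_subset_right.trans (Finset.subset_insert _ _))))
    ((Finset.subset_insert _ _).trans (Finset.subset_insert _ _))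
    (Finset.disjoint_insert_right.2 ⟨fun hh => hyN (Finset.mem_of_mem_inter_left hh), Finset.disjoint_insert_right.2
      ⟨fun hh => hzN (Finset.mem_of_mem_inter_left hh),
        Finset.disjoint_of_subset_left Finset.inter_subset_left (Finset.disjoint_of_subset_right Finset.inter_subset_left hNC)⟩⟩) hw' hm'

/-- Oracle: the plain U-drift `(C ∩ F | C ∩ F)` of the free set `N ∩ F`, root `ab` (possibly an edge of `F`).
[cite: Grimmett2006, §3.8 Thm. (3.90) (pp. 61–62)] -/
theorem orAtt_inP {N C F : Finset (Sym2 V)} {a b : V} (hF : IsTTSP F a b) (hNC : Disjoint N C) :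
    ∀ w' : ℕ → ℝ, (∀ k : ℕ, w' (k + 1) ≤ w' k) → ∀ h' : Finset (Sym2 V) → ℝ,
      (∀ ⦃A B : Finset (Sym2 V)⦄, A ⊆ B → B ⊆ N ∩ F → h' A ≤ h' B) →
      ∑ γ ∈ (N ∩ F).powerset, (w' (clusterCount (↑(insert s(a, b) (γ ∪ C ∩ F)) : BondConfig V) ∅ +
          clusterCount (↑((N ∩ F) \ γ ∪ C ∩ F) : BondConfig V) ∅) -
        w' (clusterCount (↑(insert s(a, b) ((N ∩ F) \ γ ∪ C ∩ F)) : BondConfig V) ∅ + clusterCount (↑(γ ∪ C ∩ F) : BondConfig V) ∅)) *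
          h' γ ≤ 0 :=
  fun _ hw' _ hm' => andGenW_virt_nonpos_of_isTTSP hF Finset.inter_subset_right Finset.inter_subset_right subset_rfl
    (Finset.disjoint_of_subset_left Finset.inter_subset_left (Finset.disjoint_of_subset_right Finset.inter_subset_left hNC)) hw' hm'

/-- Oracle (parallel strands): the `st`-CONTRACTED AND drift `(st, e, C ∩ F | st, C ∩ F)` of the free set `N ∩ F`, rootless, in the shape produced
by `FK.andGenW_parallel_eq`. [cite: Grimmett2006, §3.8 Thm. (3.90) (pp. 61–62)] -/
theorem orAtt_inK {N C F : Finset (Sym2 V)} {s t : V} {e : Sym2 V} (hst : s(s, t) ∉ F) (hF : IsTTSP F s t) (he : e ∈ F) (heN : e ∉ N)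
    (hNC : Disjoint N C) :
    ∀ w' : ℕ → ℝ, (∀ k : ℕ, w' (k + 1) ≤ w' k) → ∀ h' : Finset (Sym2 V) → ℝ,
      (∀ ⦃A B : Finset (Sym2 V)⦄, A ⊆ B → B ⊆ N ∩ F → h' A ≤ h' B) →
      ∑ γ ∈ (N ∩ F).powerset, (w' (clusterCount (↑(insert s(s, t) (γ ∪ insert e (C ∩ F))) : BondConfig V) ∅ +
          clusterCount (↑(insert s(s, t) ((N ∩ F) \ γ ∪ C ∩ F)) : BondConfig V) ∅) -
        w' (clusterCount (↑(insert s(s, t) ((N ∩ F) \ γ ∪ insert e (C ∩ F))) : BondConfig V) ∅ +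
          clusterCount (↑(insert s(s, t) (γ ∪ C ∩ F)) : BondConfig V) ∅)) * h' γ ≤ 0 := by
  intro w' hw' h' hm'
  have hins : ∀ X Y : Finset (Sym2 V), X ∪ insert s(s, t) Y = insert s(s, t) (X ∪ Y) := fun X Y => Finset.union_insert _ _ _
  have key := andGenW_rootless_nonpos_of_isTTSP hF Finset.inter_subset_right (A := insert s(s, t) (insert e (C ∩ F)))
    (C := insert s(s, t) (C ∩ F))
    (Finset.insert_subset_insert _ (Finset.insert_subset he Finset.inter_subset_right))
    (Finset.insert_subset_insert _ (Finset.subset_insert _ _))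
    (Finset.disjoint_insert_right.2 ⟨fun hh => hst (Finset.mem_of_mem_inter_right hh), Finset.disjoint_insert_right.2
      ⟨fun hh => heN (Finset.mem_of_mem_inter_left hh),
        Finset.disjoint_of_subset_left Finset.inter_subset_left (Finset.disjoint_of_subset_right Finset.inter_subset_left hNC)⟩⟩) hw' hm'
  simp_rw [hins] at key
  exact key

/-- Oracle (parallel strands): the `st`-CONTRACTED AND drift `(st, y, z, C ∩ F | st, C ∩ F)` of the free set `N ∩ F`, rootless.
[cite: Grimmett2006, §3.8 Thm. (3.90) (pp. 61–62)] -/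
theorem orAtt_inKK {N C F : Finset (Sym2 V)} {s t : V} {y z : Sym2 V} (hst : s(s, t) ∉ F) (hF : IsTTSP F s t) (hyF : y ∈ F) (hzF : z ∈ F)
    (hyN : y ∉ N) (hzN : z ∉ N) (hNC : Disjoint N C) :
    ∀ w' : ℕ → ℝ, (∀ k : ℕ, w' (k + 1) ≤ w' k) → ∀ h' : Finset (Sym2 V) → ℝ,
      (∀ ⦃A B : Finset (Sym2 V)⦄, A ⊆ B → B ⊆ N ∩ F → h' A ≤ h' B) →
      ∑ γ ∈ (N ∩ F).powerset, (w' (clusterCount (↑(insert s(s, t) (γ ∪ insert y (insert z (C ∩ F)))) : BondConfig V) ∅ +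
          clusterCount (↑(insert s(s, t) ((N ∩ F) \ γ ∪ C ∩ F)) : BondConfig V) ∅) -
        w' (clusterCount (↑(insert s(s, t) ((N ∩ F) \ γ ∪ insert y (insert z (C ∩ F)))) : BondConfig V) ∅ +
          clusterCount (↑(insert s(s, t) (γ ∪ C ∩ F)) : BondConfig V) ∅)) * h' γ ≤ 0 := by
  intro w' hw' h' hm'
  have hins : ∀ X Y : Finset (Sym2 V), X ∪ insert s(s, t) Y = insert s(s, t) (X ∪ Y) := fun X Y => Finset.union_insert _ _ _
  have key := andGenW_rootless_nonpos_of_isTTSP hF Finset.inter_subset_right (A := insert s(s, t) (insert y (insert z (C ∩ F))))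
    (C := insert s(s, t) (C ∩ F))
    (Finset.insert_subset_insert _ (Finset.insert_subset hyF (Finset.insert_subset hzF Finset.inter_subset_right)))
    (Finset.insert_subset_insert _ ((Finset.subset_insert _ _).trans (Finset.subset_insert _ _)))
    (Finset.disjoint_insert_right.2 ⟨fun hh => hst (Finset.mem_of_mem_inter_right hh), Finset.disjoint_insert_right.2
      ⟨fun hh => hyN (Finset.mem_of_mem_inter_left hh), Finset.disjoint_insert_right.2 ⟨fun hh => hzN (Finset.mem_of_mem_inter_left hh),
        Finset.disjoint_of_subset_left Finset.inter_subset_left (Finset.disjoint_of_subset_right Finset.inter_subset_left hNC)⟩⟩⟩)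
    hw' hm'
  simp_rw [hins] at key
  exact key

end OrAttInputs

end FK

end Summit.CriticalPhenomena.PercolationContinuityZ3.Theorems

end
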